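import Summits.HodgeConjecture.HodgeConjecture.Theorems.Ring2AbelianAllAndreRestrictedClass
import Summits.HodgeConjecture.HodgeConjecture.Theorems.Ring2AbelianAllStandardAPencilsKleimanSquare
import Literature.AlgebraicGeometry.HodgeTheory.AbelianVarietyMultiplicationPullback
import Mathlib.Algebra.Polynomial.AlgebraMap
import HarnessLib

/-!
# Ring 2 · sub-cell AbelianAll (ALL ABELIAN VARIETIES), André axis, part XLV-f — KÜNNETH COMPONENTS OF RESTRICTED ALGEBRAIC CLASSES ARE
# RESTRICTED ALGEBRAIC CLASSES: with a fibrewise multiplication `ν` (charted by `N·𝟙_A` on `X_t`), the Lagrange polynomial of `(ν_t × 𝟙)^*`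
# at the weight `Nᵏ` projects `H^{2d}(X_t × X_t)` onto its `(k, 2d−k)`-Künneth summand, commutes with `res_t`, and preserves `res_t(N^d(𝒳 × 𝒳))`

HONEST FRAMING (page 1, verbatim): **research route, not a corollary; conditional on HC_CM plus one named
minimal statement.** Cell line: research route conditional on HC_CM; not a corollary; Q11.4-sentence-2
already refuted in dim ≥ 3. Nothing in this file proves a case of the Hodge conjecture or of `B`; `HC_CM`
(`Theses.RankFourFaces.CMAbelianHodge`) does NOT occur; item `Theses.RankFourFaces.CMToAbelian` (stmt-16267) stays OPEN; N104 untouched;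
no node is born (0 `def`). Seat `pub-hodge-ring2-ab-andre-2`, gen 37. Owed item (o139) of the seat's HANDOFF, first half.

## Content (sorry-free, standard axioms; no named fact)

`f : 𝒳 ⟶ S` a compact pencil of abelian `d`-folds, `t ∈ S(ℂ)`, `res_t = (j_t × j_t)^*`. A β-witness of degree `k` is only constrained through its
ACTION on `Hᵏ(X_t)`, i.e. through the `(k, 2d−k)`-Künneth component of `res_t γ`; parts XLIV-b/XLV-b pinned the restricted class only for
ALL-degree witnesses. THIS FILE isolates the Künneth component at class level, using the θ_N-datum of parts XXIV–XXXVI on ONE fibre: an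
endomorphism `ν_t` of `X_t` charted by `N · 𝟙_A` (`N ≥ 2`) along `e : A ≅ X_t`, and (for the compatibility with `res_t`) an endomorphism `ν` of `𝒳`
with `ν_t ≫ j_t = j_t ≫ ν`.

* §1 linear algebra (any `ℂ`-space): `aeval_apply_of_intertwine` (`L ∘ p(A) = p(B) ∘ L` when `L A = B L`), `aeval_apply_of_apply_eq_smul`
  (`p(A) x = p(μ) x` when `A x = μ x`), `aeval_apply_mem_of_stable` (invariant subspaces stay invariant under `p(A)`).
* §2 **`map_fibreEndo_eq_pow_smul`** (`ν_t^* = Nⁱ` on `Hⁱ(X_t)`, from `[N]^* = Nⁱ` on `A`, the tree's `complexBetti_map_nsmul_id_apply`);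
  **`map_whiskerRight_cross_eq_pow_smul`** (`(ν_t × 𝟙)^*(pr_1^*a ∪ pr_2^*b) = N^{deg a}·(pr_1^*a ∪ pr_2^*b)`); **`map_whiskerRight_restrict`**
  (`(ν_t × 𝟙)^* ∘ res_t = res_t ∘ (ν × 𝟙)^*`); **`aeval_whiskerRight_restrict_mem_map`** — for EVERY polynomial `p`,
  `p((ν_t × 𝟙)^*)` maps `res_t(N^d(𝒳 × 𝒳))` into itself (`(ν × 𝟙)^*` preserves `N^d(𝒳 × 𝒳)` by the tree's proved Fulton pull-back).
* §3 **`exists_kunnethProjector`** — for `k ≤ 2d` there is a polynomial `p_k` (Lagrange at the weights `N⁰, …, N^{2d}`) such that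
  `P_k := p_k((ν_t × 𝟙)^*)` maps `H^{2d}(X_t × X_t)` into the span `𝒮_k` of the cross products `pr_1^*a ∪ pr_2^*b` with `deg a = k`, and
  `[P_k R]_* = [R]_*` on `Hᵏ(X_t)`, `[P_k R]_* = 0` on `H^{k'}(X_t)` for `k' ≠ k` (every `R`; cross products with `deg b ≠ 2d − k'` act by zero on
  `H^{k'}`, ab-andre-1's `corrAction_cross_eq_zero_of_ne`). With §2: **the `(k, 2d−k)`-Künneth component of a restricted algebraic class is a restricted
  algebraic class** (`kunnethProjector_restrict_mem_map`). Part XLV-g uses it to pin the lift target to ONE class per degree.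

## Honest status

Fact-free bookkeeping (Künneth + the weights of `[N]^*`, Lieberman's trick on one fibre; the projector is Deninger–Murre–Künnemann's on `X_t × X_t`
w.r.t. the first factor). Strength of the open instance unchanged; nothing minimal claimed; N104 untouched. EDGE LABELS: all K.
References: Kleiman1968AlgebraicCycles (§1.3, 2A11; Lieberman); DeningerMurre1991 (Thm. 3.1); Kunnemann1994 (§3); Fulton1998 (Cor. 19.2 (b), §16.1);
MumfordAV1970 (§1 (3)); VoisinHodgeII2003 (proof of Thm. 10.17); HatcherAT2002 (Thm. 3.15).
-/

noncomputable section

set_option linter.dupNamespace false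

namespace Summit.HodgeConjecture.HodgeConjecture.Ring2.AbelianAll

open CategoryTheory CategoryTheory.Limits AlgebraicGeometry MonoidalCategory CartesianMonoidalCategory
open Literature.AlgebraicGeometry Literature.AlgebraicGeometry.Motives
open Literature.AlgebraicGeometry.HodgeTheory
open Literature.AlgebraicTopology.SingularHomology (singularCohomology cupProduct cupProduct_map)
open Summit.HodgeConjecture.HodgeConjecture.Theorems (deg_fiberGysin_aux fulton1998_map_mem_algebraicClasses_holds)
open Polynomial

/-! ## §1 Linear algebra: polynomials in an endomorphism -/

section LinearAlgebra

variable {V W : Type*} [AddCommGroup V] [Module ℂ V] [AddCommGroup W] [Module ℂ W]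

/-- **Intertwining**: if `L (A x) = B (L x)` for all `x`, then `L (p(A) x) = p(B) (L x)` for every polynomial `p`. [folklore] -/
theorem aeval_apply_of_intertwine (A : Module.End ℂ V) (B : Module.End ℂ W) (L : V →ₗ[ℂ] W)
    (h : ∀ x, L (A x) = B (L x)) (p : ℂ[X]) (x : V) : L (aeval A p x) = aeval B p (L x) := by
  induction p using Polynomial.induction_on' generalizing x with
  | add p q hp hq => rw [map_add, map_add, LinearMap.add_apply, LinearMap.add_apply, map_add, hp, hq]
  | monomial n c =>
    rw [aeval_monomial, aeval_monomial, Module.End.mul_apply, Module.End.mul_apply, Module.algebraMap_end_apply,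
      Module.algebraMap_end_apply, map_smul]
    congr 1
    induction n generalizing x with
    | zero => rw [pow_zero, pow_zero, Module.End.one_apply, Module.End.one_apply]
    | succ n ih => rw [pow_succ, pow_succ, Module.End.mul_apply, Module.End.mul_apply, ih (A x), h]

/-- **Eigenvectors**: if `A x = μ x` then `p(A) x = p(μ) x`. [folklore] -/
theorem aeval_apply_of_apply_eq_smul (A : Module.End ℂ V) {μ : ℂ} {x : V} (hx : A x = μ • x) (p : ℂ[X]) :
    aeval A p x = p.eval μ • x := by
  have key : ∀ n : ℕ, (A ^ n) x = μ ^ n • x := by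
    intro n
    induction n with
    | zero => rw [pow_zero, pow_zero, Module.End.one_apply, one_smul]
    | succ n ih => rw [pow_succ', Module.End.mul_apply, ih, map_smul, hx, smul_smul, ← pow_succ]
  induction p using Polynomial.induction_on' with
  | add p q hp hq => rw [map_add, LinearMap.add_apply, hp, hq, eval_add, add_smul]
  | monomial n c => rw [aeval_monomial, Module.End.mul_apply, Module.algebraMap_end_apply, key, smul_smul, eval_monomial]

/-- **Invariant subspaces**: if `A` maps `M` into `M`, so does `p(A)` (cf. the tree's `Motives.aeval_apply_mem_of_forall_mem` in
`MumfordTateInvariantsSubHodge`, not imported here to keep the closure light). [folklore] -/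
theorem aeval_apply_mem_of_stable (A : Module.End ℂ V) (M : Submodule ℂ V) (hM : ∀ x ∈ M, A x ∈ M) (p : ℂ[X])
    {x : V} (hx : x ∈ M) : aeval A p x ∈ M := by
  induction p using Polynomial.induction_on' with
  | add p q hp hq =>
    rw [map_add, LinearMap.add_apply]
    exact M.add_mem hp hq
  | monomial n c =>
    rw [aeval_monomial, Module.End.mul_apply, Module.algebraMap_end_apply]
    refine M.smul_mem c ?_
    induction n with
    | zero => simpa only [pow_zero, Module.End.one_apply] using hx
    | succ n ih =>
      rw [pow_succ', Module.End.mul_apply]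
      exact hM _ ih

/-- **Lagrange evaluation**: for distinct nodes `w 0, …, w m` (indexed by `Finset.range (m+1)`) and `k ≤ m`, the polynomial
`p_k = C (∏_{j ≠ k} (w k − w j))⁻¹ · ∏_{j ≠ k} (X − C (w j))` satisfies `p_k(w i) = δ_{ik}` for `i ≤ m`. [folklore] -/
theorem eval_lagrangeNode (w : ℕ → ℂ) (hw : ∀ i j, w i = w j → i = j) {m k : ℕ} (hk : k ≤ m) {i : ℕ} (hi : i ≤ m) :
    (C (∏ j ∈ (Finset.range (m + 1)).erase k, (w k - w j))⁻¹ *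
        ∏ j ∈ (Finset.range (m + 1)).erase k, (X - C (w j))).eval (w i) = if i = k then 1 else 0 := by
  rw [eval_mul, eval_C, eval_prod]
  simp only [eval_sub, eval_X, eval_C]
  split_ifs with hik
  · subst hik
    refine inv_mul_cancel₀ (Finset.prod_ne_zero_iff.2 fun j hj ↦ ?_)
    exact sub_ne_zero.2 fun h ↦ (Finset.ne_of_mem_erase hj) (hw _ _ h).symm
  · have hmem : i ∈ (Finset.range (m + 1)).erase k := Finset.mem_erase.2 ⟨hik, Finset.mem_range.2 (by omega)⟩
    rw [Finset.prod_eq_zero (f := fun j ↦ w i - w j) hmem (sub_self _), mul_zero]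

end LinearAlgebra

/-! ## §2 The weights of `(ν_t × 𝟙)^*` on `H•(X_t × X_t)` and the compatibility with `res_t` -/

section Weights

variable {𝒳 S : SchemeOver ℂ} {d : ℕ} {f : 𝒳 ⟶ S} (hf : IsCompactAbelianPencil f d)

/-- **`ν_t^* = Nⁱ` on `Hⁱ(X_t)`** for an endomorphism `ν_t` of the fibre charted by `N · 𝟙_A` along `e : A ≅ X_t` (`[N]^* = Nⁱ` on `Hⁱ(A(ℂ))`,
the tree's `complexBetti_map_nsmul_id_apply`, transported along the isomorphism `e`). [cite: MumfordAV1970, §1 (3) and §19] -/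
theorem map_fibreEndo_eq_pow_smul (t : ComplexPoints S) (νt : fiberOver f t ⟶ fiberOver f t) (A : AbelianVariety ℂ)
    (e : A.X ≅ fiberOver f t) {N : ℕ} (he : e.hom ≫ νt = (N • 𝟙 A).hom.hom.hom ≫ e.hom) (i : ℕ)
    (y : complexBetti (fiberOver f t) i) : complexBetti.map νt i y = ((N : ℂ) ^ i) • y := by
  have h1 : complexBetti.map e.hom i (complexBetti.map νt i y) = complexBetti.map e.hom i (((N : ℂ) ^ i) • y) := by
    rw [← CategoryTheory.comp_apply, ← complexBetti.map_comp, he, complexBetti.map_comp, CategoryTheory.comp_apply,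
      complexBetti_map_nsmul_id_apply, map_smul]
  have hinj : Function.Injective (complexBetti.map e.hom i) := by
    intro a b hab
    have h := congrArg (complexBetti.map e.inv i) hab
    rwa [← CategoryTheory.comp_apply, ← CategoryTheory.comp_apply, ← complexBetti.map_comp, Iso.inv_hom_id,
      complexBetti.map_id, CategoryTheory.id_apply, CategoryTheory.id_apply] at h
  exact hinj h1

/-- **`(ν_t × 𝟙)^*(pr_1^* a ∪ pr_2^* b) = N^{deg a} · (pr_1^* a ∪ pr_2^* b)`**: cross products are weight vectors of `(ν_t × 𝟙)^*`, the weight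
recording the degree of the FIRST factor (Lieberman's trick on the fibre square). [cite: Kleiman1968AlgebraicCycles, Appendix to §2, 2A11]
[cite: HatcherAT2002, §3.2 Prop. 3.10] -/
theorem map_whiskerRight_cross_eq_pow_smul (t : ComplexPoints S) (νt : fiberOver f t ⟶ fiberOver f t) (A : AbelianVariety ℂ)
    (e : A.X ≅ fiberOver f t) {N : ℕ} (he : e.hom ≫ νt = (N • 𝟙 A).hom.hom.hom ≫ e.hom) {i j n : ℕ} (h : i + j = n)
    (a : complexBetti (fiberOver f t) i) (b : complexBetti (fiberOver f t) j) :
    complexBetti.map (νt ▷ fiberOver f t) n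
        (cupProduct h (complexBetti.map (fst (fiberOver f t) (fiberOver f t)) i a)
          (complexBetti.map (snd (fiberOver f t) (fiberOver f t)) j b)) =
      ((N : ℂ) ^ i) • cupProduct h (complexBetti.map (fst (fiberOver f t) (fiberOver f t)) i a)
        (complexBetti.map (snd (fiberOver f t) (fiberOver f t)) j b) := by
  have e₁ : complexBetti.map (νt ▷ fiberOver f t) i (complexBetti.map (fst (fiberOver f t) (fiberOver f t)) i a) =
      ((N : ℂ) ^ i) • complexBetti.map (fst (fiberOver f t) (fiberOver f t)) i a := by
    rw [← CategoryTheory.comp_apply, ← complexBetti.map_comp, whiskerRight_fst, complexBetti.map_comp, CategoryTheory.comp_apply,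
      map_fibreEndo_eq_pow_smul t νt A e he i a, map_smul]
  have e₂ : complexBetti.map (νt ▷ fiberOver f t) j (complexBetti.map (snd (fiberOver f t) (fiberOver f t)) j b) =
      complexBetti.map (snd (fiberOver f t) (fiberOver f t)) j b := by
    rw [← CategoryTheory.comp_apply, ← complexBetti.map_comp, whiskerRight_snd]
  rw [cupProduct_map, e₁, e₂, LinearMap.map_smul₂]

/-- **`(ν_t × 𝟙)^* ∘ res_t = res_t ∘ (ν × 𝟙)^*`** for an endomorphism `ν` of `𝒳` restricting to `ν_t` on `X_t` (`(ν_t × 𝟙) ≫ (j_t × j_t) = (j_t × j_t) ≫ (ν × 𝟙)`).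
[folklore] -/
theorem map_whiskerRight_restrict (t : ComplexPoints S) (ν : 𝒳 ⟶ 𝒳) (νt : fiberOver f t ⟶ fiberOver f t)
    (hνt : νt ≫ fiberι f t = fiberι f t ≫ ν) {n : ℕ} (γ : complexBetti (𝒳 ⊗ 𝒳) n) :
    complexBetti.map (νt ▷ fiberOver f t) n (complexBetti.map (fiberι f t ⊗ₘ fiberι f t) n γ) =
      complexBetti.map (fiberι f t ⊗ₘ fiberι f t) n (complexBetti.map (ν ▷ 𝒳) n γ) := by
  have hsq : (νt ▷ fiberOver f t) ≫ (fiberι f t ⊗ₘ fiberι f t) = (fiberι f t ⊗ₘ fiberι f t) ≫ (ν ▷ 𝒳) := by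
    ext
    · simp only [Category.assoc, tensorHom_fst, whiskerRight_fst, whiskerRight_fst_assoc, tensorHom_fst_assoc, hνt]
    · simp only [Category.assoc, tensorHom_snd, whiskerRight_snd, whiskerRight_snd_assoc]
  rw [← CategoryTheory.comp_apply, ← complexBetti.map_comp, hsq, complexBetti.map_comp, CategoryTheory.comp_apply]

include hf in
/-- **Every polynomial in `(ν_t × 𝟙)^*` maps `res_t(N^d(𝒳 × 𝒳))` into itself**: `p((ν_t × 𝟙)^*)(res_t γ) = res_t(p((ν × 𝟙)^*) γ)` (§1 intertwining
with the previous lemma) and `(ν × 𝟙)^*` preserves `N^d(𝒳 × 𝒳)` (Fulton Cor. 19.2 (b), the tree's theorem). [cite: Fulton1998, §19.2 Cor. 19.2 (b)]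
[cite: Kleiman1968AlgebraicCycles, Appendix to §2, 2A11] -/
theorem aeval_whiskerRight_restrict_mem_map (t : ComplexPoints S) (ν : 𝒳 ⟶ 𝒳) (νt : fiberOver f t ⟶ fiberOver f t)
    (hνt : νt ≫ fiberι f t = fiberι f t ≫ ν) (p : ℂ[X]) {γ : complexBetti (𝒳 ⊗ 𝒳) (2 * d)}
    (hγ : γ ∈ algebraicClasses (𝒳 ⊗ 𝒳) d) :
    aeval (complexBetti.map (νt ▷ fiberOver f t) (2 * d)).hom p (complexBetti.map (fiberι f t ⊗ₘ fiberι f t) (2 * d) γ) ∈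
      (algebraicClasses (𝒳 ⊗ 𝒳) d).map (complexBetti.map (fiberι f t ⊗ₘ fiberι f t) (2 * d)).hom := by
  have hX := hf.isSmoothProjective_total
  have hXX := hX.tensor_holds hX
  rw [← aeval_apply_of_intertwine (complexBetti.map (ν ▷ 𝒳) (2 * d)).hom (complexBetti.map (νt ▷ fiberOver f t) (2 * d)).hom
    (complexBetti.map (fiberι f t ⊗ₘ fiberι f t) (2 * d)).hom (fun x ↦ (map_whiskerRight_restrict t ν νt hνt x).symm) p γ]
  refine Submodule.mem_map_of_mem (aeval_apply_mem_of_stable _ _ (fun x hx ↦ ?_) p hγ)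
  exact fulton1998_map_mem_algebraicClasses_holds (ν ▷ 𝒳) hXX hXX d x hx

end Weights

/-! ## §3 The Künneth projector of the fibre square and its action -/

section Projector

variable {𝒳 S : SchemeOver ℂ} {d : ℕ} {f : 𝒳 ⟶ S} (hf : IsCompactAbelianPencil f d)

/-- `𝐑[hf, t, k]` — the action on `Hᵏ(X_t(ℂ); ℂ)` of a codimension-`d` class of `X_t × X_t`, complex orientations (display notation, as in
part XLIV-b). [cite: VoisinHodgeII2003, proof of Thm. 10.17 (10.7)] -/
local notation3 (prettyPrint := false) "𝐑[" hf ", " t ", " k "]" =>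
  corrAction complexOrientationFamily (IsCompactAbelianPencil.isSmoothProjective_fiberOver hf t)
    (IsCompactAbelianPencil.isSmoothProjective_fiberOver hf t) (rfl : k + 2 * d = k + 2 * d)

/-- **THE KÜNNETH PROJECTOR `P_k` OF THE FIBRE SQUARE.** For a compact pencil of abelian `d`-folds, `t ∈ S(ℂ)`, an endomorphism `ν_t` of `X_t`
charted by `N · 𝟙_A` (`N ≥ 2`) and `k ≤ 2d`, there is a polynomial `p` (Lagrange at the weights `N⁰, …, N^{2d}`) such that `P := p((ν_t × 𝟙)^*)` on
`H^{2d}((X_t × X_t)(ℂ); ℂ)` satisfies: (i) `P R` lies in the span `𝒮_k` of the cross products `pr_1^* a ∪ pr_2^* b` with `deg a = k` (every `R`);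
(ii) `[P R]_* = [R]_*` on `Hᵏ(X_t)`; (iii) `[P R]_* = 0` on `H^{k'}(X_t)` for `k' ≠ k`. Proof: cross products span (Künneth), `pr_1^*a ∪ pr_2^*b` has
weight `N^{deg a}` (§2), `p(Nⁱ) = δ_{ik}` for `i ≤ 2d`, and a cross product with `deg b ≠ 2d − k'` acts by zero on `H^{k'}` (ab-andre-1's
`corrAction_cross_eq_zero_of_ne`). [cite: Kleiman1968AlgebraicCycles, §1.3 and Appendix to §2, 2A11] [cite: DeningerMurre1991, Thm. 3.1]
[cite: HatcherAT2002, §3.2 Thm. 3.15] -/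
theorem exists_kunnethProjector (t : ComplexPoints S) (νt : fiberOver f t ⟶ fiberOver f t) (A : AbelianVariety ℂ)
    (e : A.X ≅ fiberOver f t) {N : ℕ} (hN : 2 ≤ N) (he : e.hom ≫ νt = (N • 𝟙 A).hom.hom.hom ≫ e.hom) {k : ℕ} (hk : k ≤ 2 * d) :
    ∃ p : ℂ[X], ∀ R : complexBetti (fiberOver f t ⊗ fiberOver f t) (2 * d),
      aeval (complexBetti.map (νt ▷ fiberOver f t) (2 * d)).hom p R ∈ Submodule.span ℂ
          {v | ∃ (j : ℕ) (h : k + j = 2 * d) (a : complexBetti (fiberOver f t) k) (b : complexBetti (fiberOver f t) j),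
            v = cupProduct h (complexBetti.map (fst (fiberOver f t) (fiberOver f t)) k a)
              (complexBetti.map (snd (fiberOver f t) (fiberOver f t)) j b)} ∧
        𝐑[hf, t, k] (aeval (complexBetti.map (νt ▷ fiberOver f t) (2 * d)).hom p R) = 𝐑[hf, t, k] R ∧
        ∀ k' : ℕ, k' ≠ k → 𝐑[hf, t, k'] (aeval (complexBetti.map (νt ▷ fiberOver f t) (2 * d)).hom p R) = 0 := by
  have hXt := hf.isSmoothProjective_fiberOver t
  obtain ⟨w, hw⟩ : ∃ w : ℕ → ℂ, ∀ i, w i = (N : ℂ) ^ i := ⟨_, fun _ ↦ rfl⟩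
  have hwinj : ∀ i j, w i = w j → i = j := by
    intro i j h
    rw [hw, hw] at h
    exact Nat.pow_right_injective hN (by exact_mod_cast h)
  refine ⟨C (∏ j ∈ (Finset.range (2 * d + 1)).erase k, (w k - w j))⁻¹ * ∏ j ∈ (Finset.range (2 * d + 1)).erase k, (X - C (w j)),
    fun R ↦ ?_⟩
  -- the value of `p(T)` on a cross product
  have hcross : ∀ (i j : ℕ) (h : i + j = 2 * d) (a : complexBetti (fiberOver f t) i) (b : complexBetti (fiberOver f t) j),
      aeval (complexBetti.map (νt ▷ fiberOver f t) (2 * d)).hom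
        (C (∏ j ∈ (Finset.range (2 * d + 1)).erase k, (w k - w j))⁻¹ * ∏ j ∈ (Finset.range (2 * d + 1)).erase k, (X - C (w j)))
        (cupProduct h (complexBetti.map (fst (fiberOver f t) (fiberOver f t)) i a)
          (complexBetti.map (snd (fiberOver f t) (fiberOver f t)) j b)) =
      (if i = k then (1 : ℂ) else 0) • cupProduct h (complexBetti.map (fst (fiberOver f t) (fiberOver f t)) i a)
        (complexBetti.map (snd (fiberOver f t) (fiberOver f t)) j b) := by
    intro i j h a b
    have heig := map_whiskerRight_cross_eq_pow_smul t νt A e he h a b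
    rw [← hw i] at heig
    rw [aeval_apply_of_apply_eq_smul _ heig, eval_lagrangeNode w hwinj (m := 2 * d) hk (show i ≤ 2 * d by omega)]
  refine ⟨?_, ?_, fun k' hk' ↦ ?_⟩
  · -- (i) `p(T) R ∈ 𝒮_k`
    refine Submodule.span_induction ?_ ?_ (fun x y _ _ hx hy ↦ ?_) (fun c x _ hx ↦ ?_) (kunnethSpan_complexBetti hXt hXt (2 * d) R)
    · rintro _ ⟨i, j, h, a, b, rfl⟩
      rw [hcross i j h a b]
      split_ifs with hik
      · subst hik
        rw [one_smul]
        exact Submodule.subset_span ⟨j, h, a, b, rfl⟩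
      · rw [zero_smul]
        exact Submodule.zero_mem _
    · rw [map_zero]
      exact Submodule.zero_mem _
    · rw [map_add]
      exact Submodule.add_mem _ hx hy
    · rw [map_smul]
      exact Submodule.smul_mem _ c hx
  · -- (ii) same action on `Hᵏ`
    have key : Set.EqOn
        (𝐑[hf, t, k] ∘ₗ aeval (complexBetti.map (νt ▷ fiberOver f t) (2 * d)).hom
          (C (∏ j ∈ (Finset.range (2 * d + 1)).erase k, (w k - w j))⁻¹ * ∏ j ∈ (Finset.range (2 * d + 1)).erase k, (X - C (w j))))
        𝐑[hf, t, k]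
        {v | ∃ (i j : ℕ) (h : i + j = 2 * d) (a : complexBetti (fiberOver f t) i) (b : complexBetti (fiberOver f t) j),
          v = cupProduct h (complexBetti.map (fst (fiberOver f t) (fiberOver f t)) i a)
            (complexBetti.map (snd (fiberOver f t) (fiberOver f t)) j b)} := by
      rintro _ ⟨i, j, h, a, b, rfl⟩
      rw [LinearMap.comp_apply, hcross i j h a b]
      split_ifs with hik
      · rw [one_smul]
      · rw [zero_smul, map_zero]
        refine (LinearMap.ext fun c ↦ ?_).symm
        rw [LinearMap.zero_apply]
        exact corrAction_cross_eq_zero_of_ne hXt hXt h rfl (by omega) a b c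
    exact LinearMap.eqOn_span' key (kunnethSpan_complexBetti hXt hXt (2 * d) R)
  · -- (iii) zero action on `H^{k'}`, `k' ≠ k`
    have key : Set.EqOn
        (𝐑[hf, t, k'] ∘ₗ aeval (complexBetti.map (νt ▷ fiberOver f t) (2 * d)).hom
          (C (∏ j ∈ (Finset.range (2 * d + 1)).erase k, (w k - w j))⁻¹ * ∏ j ∈ (Finset.range (2 * d + 1)).erase k, (X - C (w j))))
        (0 : complexBetti (fiberOver f t ⊗ fiberOver f t) (2 * d) →ₗ[ℂ]
          (complexBetti (fiberOver f t) k' →ₗ[ℂ] complexBetti (fiberOver f t) k'))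
        {v | ∃ (i j : ℕ) (h : i + j = 2 * d) (a : complexBetti (fiberOver f t) i) (b : complexBetti (fiberOver f t) j),
          v = cupProduct h (complexBetti.map (fst (fiberOver f t) (fiberOver f t)) i a)
            (complexBetti.map (snd (fiberOver f t) (fiberOver f t)) j b)} := by
      rintro _ ⟨i, j, h, a, b, rfl⟩
      rw [LinearMap.comp_apply, LinearMap.zero_apply, hcross i j h a b]
      split_ifs with hik
      · subst hik
        rw [one_smul]
        refine LinearMap.ext fun c ↦ ?_
        rw [LinearMap.zero_apply]
        exact corrAction_cross_eq_zero_of_ne hXt hXt h rfl (by omega) a b c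
      · rw [zero_smul, map_zero]
    have h := LinearMap.eqOn_span' key (kunnethSpan_complexBetti hXt hXt (2 * d) R)
    simpa only [LinearMap.comp_apply, LinearMap.zero_apply] using h

/-- **THE KÜNNETH COMPONENT OF A RESTRICTED ALGEBRAIC CLASS IS A RESTRICTED ALGEBRAIC CLASS.** With an endomorphism `ν` of `𝒳` restricting to
`ν_t` on `X_t` (charted by `N · 𝟙_A`, `N ≥ 2`) and `k ≤ 2d`: for every algebraic `γ ∈ N^d H^{2d}((𝒳 × 𝒳)(ℂ))` there is a class `R` in the IMAGE
`res_t(N^d(𝒳 × 𝒳))` — hence algebraic on `X_t × X_t`, part XLV-b §1 — lying in the `(k, 2d−k)`-Künneth span `𝒮_k`, with `[R]_* = [res_t γ]_*` on `Hᵏ(X_t)`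
and `[R]_* = 0` on every other `H^{k'}(X_t)`: `R = P_k(res_t γ) = res_t(p_k((ν × 𝟙)^*) γ)` (§2, §3). [cite: Kleiman1968AlgebraicCycles, Appendix to §2, 2A11]
[cite: Fulton1998, §19.2 Cor. 19.2 (b)] [cite: DeningerMurre1991, Thm. 3.1] -/
theorem kunnethProjector_restrict_mem_map (t : ComplexPoints S) (ν : 𝒳 ⟶ 𝒳) (νt : fiberOver f t ⟶ fiberOver f t)
    (hνt : νt ≫ fiberι f t = fiberι f t ≫ ν) (A : AbelianVariety ℂ) (e : A.X ≅ fiberOver f t) {N : ℕ} (hN : 2 ≤ N)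
    (he : e.hom ≫ νt = (N • 𝟙 A).hom.hom.hom ≫ e.hom) {k : ℕ} (hk : k ≤ 2 * d) {γ : complexBetti (𝒳 ⊗ 𝒳) (2 * d)}
    (hγ : γ ∈ algebraicClasses (𝒳 ⊗ 𝒳) d) :
    ∃ R ∈ (algebraicClasses (𝒳 ⊗ 𝒳) d).map (complexBetti.map (fiberι f t ⊗ₘ fiberι f t) (2 * d)).hom,
      R ∈ Submodule.span ℂ
          {v | ∃ (j : ℕ) (h : k + j = 2 * d) (a : complexBetti (fiberOver f t) k) (b : complexBetti (fiberOver f t) j),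
            v = cupProduct h (complexBetti.map (fst (fiberOver f t) (fiberOver f t)) k a)
              (complexBetti.map (snd (fiberOver f t) (fiberOver f t)) j b)} ∧
        𝐑[hf, t, k] R = 𝐑[hf, t, k] (complexBetti.map (fiberι f t ⊗ₘ fiberι f t) (2 * d) γ) ∧
        ∀ k' : ℕ, k' ≠ k → 𝐑[hf, t, k'] R = 0 := by
  obtain ⟨p, hp⟩ := exists_kunnethProjector hf t νt A e hN he hk
  obtain ⟨h1, h2, h3⟩ := hp (complexBetti.map (fiberι f t ⊗ₘ fiberι f t) (2 * d) γ)
  exact ⟨_, aeval_whiskerRight_restrict_mem_map hf t ν νt hνt p hγ, h1, h2, h3⟩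

end Projector

end Summit.HodgeConjecture.HodgeConjecture.Ring2.AbelianAll

end
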